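import Summits.AtomisticToContinuum.HydrodynamicLimit.Theses.RelayRaceLocality

/-!
# Vocabulary of the line `Sketch` for the crux `LightConeInLaw`
(stmt-AtomisticToContinuum-12500; rank 2 of route `RelayRaceLocality`, sub-problem `HydrodynamicLimit`)

Definitions-only support file (`--supports stmt-AtomisticToContinuum-12500`) of the line lead of the
line `Sketch` (registered skeleton `Cruxes/LightConeInLaw/Lines/Sketch.lean`, stubs `stub_timeZero`,
`stub_profileIdOne`, `stub_profileId`, `stub_core`; composition
`LightConeInLaw_of : stub_timeZero → stub_profileIdOne → stub_profileId → stub_core → LightConeInLaw`,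
kernel-checked modulo the stubs). It makes the line's vocabulary IMPORTABLE so that each registered
stub can land in its own sorry-free Theorems file with the registered signature verbatim:

* `G3` — the hard-sphere geometry of the flat `3`-torus (`Torus.geometry (Fin 3)`);
* `LLNAt n P Φ ρ U Θ t` — the law of large numbers at time `t` for a general family (`n N` spheres,
  laws `P N`, flows `Φ N`) towards space-only fields `(ρ, U, Θ)`: the crux's inline LLN hypothesis
  for the comparison gas, and `TendstoHydroFieldsAt P Φ ρ' U' Θ' t` for the conjunct's gas with
  `ρ = ρ' t`, `U = U' t`, `Θ = Θ' t` (`tendstoHydroFieldsAt_iff_LLNAt`, by `Iff.rfl`);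
* `tendsto_atTop_of_mul_hsDiameter` — the comparison particle number diverges:
  `n₂ N · hsDiameter σ₁ N ^ 3 → σ₂ ^ 3 > 0` forces `n₂ N → ∞` (used by the composition to feed
  `stub_profileId`; registered on the item).

Nothing is asserted: `LLNAt` is a predicate, never a hypothesis taken as a fact.
-/

namespace Summit.AtomisticToContinuum.HydrodynamicLimit.Theorems.LightConeInLawSketch

open scoped BigOperators Topology Classical ENNReal
open Filter Set MeasureTheory
open Literature.MathematicalPhysics.KineticTheory Literature.Analysis.FluidPDE

noncomputable section

/-- The hard-sphere geometry of the flat `3`-torus (the crux's `Torus.geometry (Fin 3)`). -/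
abbrev G3 : Geometry (Fin 3) T3 := Torus.geometry (Fin 3)

/-- **Law of large numbers at time `t`** for a general family (`n N` spheres of diameters `ε N`,
laws `P N`, flows `Φ N`) towards the space-only fields `(ρ, U, Θ)`: for every continuous `χ` and
`δ > 0` the `P N`-probabilities that the empirical density / momentum / energy field of `Φ N t z`
tested against `χ` deviates by more than `δ` from `∫ χρ`, `∫ χρU`, `∫ χE(ρ,U,Θ)` tend to `0`.
Verbatim the crux's inline hypothesis for gas 2 (with `ρ = ρ₂ 0`, …); a predicate, not a fact. -/
def LLNAt (n : ℕ → ℕ) {ε : ℕ → ℝ} (P : (N : ℕ) → Measure (Config (n N) (Fin 3) T3))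
    (Φ : (N : ℕ) → HardSphereFlow G3 (ε N) (n N)) (ρ : T3 → ℝ) (U : T3 → V3) (Θ : T3 → ℝ)
    (t : ℝ) : Prop :=
  ∀ χ : T3 → ℝ, Continuous χ → ∀ δ : ℝ, 0 < δ →
    Tendsto (fun N => P N {z | δ < |empiricalDensityField ((Φ N).flow t z) χ - ∫ x, χ x * ρ x|})
      atTop (𝓝 0) ∧
    Tendsto (fun N => P N {z | δ < ‖empiricalMomentumField ((Φ N).flow t z) χ -
      ∫ x, (χ x * ρ x) • U x‖}) atTop (𝓝 0) ∧
    Tendsto (fun N => P N {z | δ < |empiricalEnergyField ((Φ N).flow t z) χ -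
      ∫ x, χ x * totalEnergyDensity (ρ x) (U x) (Θ x)|}) atTop (𝓝 0)

/-- The conjunct's `TendstoHydroFieldsAt P Φ ρ U Θ t` IS `LLNAt (fun N => N + 1) P Φ (ρ t) (U t)
(Θ t) t` (unfolding both). -/
theorem tendstoHydroFieldsAt_iff_LLNAt {ε : ℕ → ℝ}
    (P : (N : ℕ) → Measure (Config (N + 1) (Fin 3) T3))
    (Φ : (N : ℕ) → HardSphereFlow G3 (ε N) (N + 1))
    (ρ : ℝ → T3 → ℝ) (U : ℝ → T3 → V3) (Θ : ℝ → T3 → ℝ) (t : ℝ) :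
    TendstoHydroFieldsAt P Φ ρ U Θ t ↔ LLNAt (fun N => N + 1) P Φ (ρ t) (U t) (Θ t) t :=
  Iff.rfl

/-- **The comparison particle number diverges.** If `n₂ N · hsDiameter σ₁ N ^ 3 → σ₂ ^ 3` with
`σ₁, σ₂ > 0` then `n₂ N → ∞`, because `hsDiameter σ₁ N ^ 3 = σ₁³ / (N + 1)`
(`succ_mul_hsDiameter_pow_three`). -/
theorem tendsto_atTop_of_mul_hsDiameter :
    ∀ (σ₁ σ₂ : ℝ), 0 < σ₁ → 0 < σ₂ → ∀ n₂ : ℕ → ℕ,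
      Tendsto (fun N => (n₂ N : ℝ) * hsDiameter σ₁ N ^ 3) atTop (𝓝 (σ₂ ^ 3)) →
      Tendsto n₂ atTop atTop := by
  intro σ₁ σ₂ hσ₁ hσ₂ n₂ h
  have hε : ∀ N : ℕ, hsDiameter σ₁ N ^ 3 = σ₁ ^ 3 / ((N + 1 : ℕ) : ℝ) := fun N => by
    have h1 := succ_mul_hsDiameter_pow_three σ₁ N
    have hN : (0 : ℝ) < ((N + 1 : ℕ) : ℝ) := by positivity
    rw [eq_div_iff hN.ne', mul_comm]
    exact h1
  have hrew : ∀ N : ℕ, (n₂ N : ℝ) =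
      ((n₂ N : ℝ) * hsDiameter σ₁ N ^ 3) * (((N + 1 : ℕ) : ℝ) / σ₁ ^ 3) := fun N => by
    have hN : (0 : ℝ) < ((N + 1 : ℕ) : ℝ) := by positivity
    rw [hε]
    field_simp
  have h2 : Tendsto (fun N : ℕ => ((N + 1 : ℕ) : ℝ) / σ₁ ^ 3) atTop atTop :=
    Tendsto.atTop_div_const (pow_pos hσ₁ 3)
      (tendsto_natCast_atTop_atTop.comp (tendsto_add_atTop_nat 1))
  have h3 := h.pos_mul_atTop (pow_pos hσ₂ 3) h2
  rw [← tendsto_natCast_atTop_iff (R := ℝ)]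
  refine h3.congr fun N => ?_
  exact (hrew N).symm

end

end Summit.AtomisticToContinuum.HydrodynamicLimit.Theorems.LightConeInLawSketch
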